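import Mathlib
import Literature.Geometry.DiscreteGeometry.TwoShellPatterns

/-!
# Descent lemma for the line `Sketch` of crux `PhononSlackCertificates.NearFarGlueR`

Stub `stub_descent` of the skeleton for item stmt-AtomisticToContinuum-14970 (route
`PhononSlackCertificates`, crux `NearFarGlueR`).

**Statement.**  Granted the two covering facts (for every unit vector `w` some first-shell
direction `v` of the fcc resp. hcp two-shell pattern has `⟪v, w⟫ ≥ 1/4`), if particle `i` is
`1/20`-good on the window `[47/50, 1]` and particle `j` is farther than `3` from `x i`, then some
particle `k ≠ i` within `21/20` of `x i` (an occupied first-shell site of `i`) is STRICTLY closer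
to `x j` than `x i` is.

**Proof.**  Let `d = dist (x j) (x i) > 3`, `u = (x j - x i)/d`, and let `a ∈ [47/50, 1]`, `A`,
`P`, `f` witness the goodness of `i`.  The linear isometry `A` of `ℝ³` is onto (finite dimension),
so `u = A w` with `‖w‖ = 1`; the covering fact gives `v ∈ P`, `‖v‖ = 1`, `⟪A v, u⟫ = ⟪v, w⟫ ≥ 1/4`.
Put `k = f v`, `y = x k - x i`, `z = a • A v`: `‖y - z‖ ≤ a/20`, `‖z‖ = a`, so `‖y‖ ≤ 21a/20 ≤ 21/20`
and `⟪x j - x i, y⟫ ≥ d a/4 - d a/20 = d a/5`; hence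
`dist (x j) (x k)² = d² - 2⟪x j - x i, y⟫ + ‖y‖² ≤ d² - 2da/5 + (21a/20)² < d²`
because `441 a/400 ≤ 441/400 < 6/5 < 2d/5`.
-/

noncomputable section

namespace Summit.AtomisticToContinuum.Crystallization.Theorems.PhononSlackCertificatesNearFarGlueR

open Literature.Geometry.DiscreteGeometry
open scoped BigOperators RealInnerProductSpace

/-- **Core estimate of the descent lemma.**  In a real inner product space let `‖p‖ = d > 3`,
`‖z‖ = a` with `0 < a ≤ 1`, `‖y - z‖ ≤ a/20` and `⟪p, z⟫ ≥ d a/4`.  Then `‖y‖ ≤ 21/20` and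
`‖p - y‖ < d`. [folklore] -/
theorem descent_core {p y z : EuclideanSpace ℝ (Fin 3)} {d a : ℝ} (hd : 3 < d) (ha0 : 0 < a)
    (ha1 : a ≤ 1) (hp : ‖p‖ = d) (hz : ‖z‖ = a) (hyz : ‖y - z‖ ≤ a / 20)
    (hinner : d * a / 4 ≤ ⟪p, z⟫) : ‖y‖ ≤ 21 / 20 ∧ ‖p - y‖ < d := by
  have hy : ‖y‖ ≤ 21 / 20 * a := by
    have h := norm_sub_norm_le y z
    linarith
  refine ⟨by nlinarith, ?_⟩
  have h1 : |⟪p, y - z⟫| ≤ d * (a / 20) := by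
    calc |⟪p, y - z⟫| ≤ ‖p‖ * ‖y - z‖ := abs_real_inner_le_norm p (y - z)
      _ ≤ d * (a / 20) := by
          rw [hp]
          exact mul_le_mul_of_nonneg_left hyz (by linarith)
  have h1' := (abs_le.1 h1).1
  have h2 : ⟪p, y⟫ = ⟪p, z⟫ + ⟪p, y - z⟫ := by
    rw [inner_sub_right]
    ring
  have h3 : d * a / 5 ≤ ⟪p, y⟫ := by
    rw [h2]
    linarith
  have hyy : ‖y‖ ^ 2 ≤ (21 / 20 * a) ^ 2 := pow_le_pow_left₀ (norm_nonneg y) hy 2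
  have hda : 3 * a < d * a := mul_lt_mul_of_pos_right hd ha0
  have haa : a ^ 2 ≤ a := by nlinarith
  have h4 : ‖p - y‖ ^ 2 < d ^ 2 := by
    rw [norm_sub_sq_real, hp]
    nlinarith
  exact lt_of_pow_lt_pow_left₀ 2 (by linarith) h4

/-- **Descent lemma** (stub `stub_descent` of line `Sketch`, crux `NearFarGlueR`).  Granted the
`1/4`-covering of the unit sphere by the first-shell directions of both two-shell patterns: if
particle `i` is `1/20`-good on the window `[47/50, 1]` and particle `j` is farther than `3` from
`x i`, then some particle `k ≠ i` within `21/20` of `x i` is strictly closer to `x j` than `x i` is.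
(The badness of `j` is not used.) [folklore] -/
theorem stub_descent :
    (∀ w : EuclideanSpace ℝ (Fin 3), ‖w‖ = 1 →
      ∃ v ∈ fccTwoShellPattern, ‖v‖ = 1 ∧ (1 / 4 : ℝ) ≤ ⟪v, w⟫) →
    (∀ w : EuclideanSpace ℝ (Fin 3), ‖w‖ = 1 →
      ∃ v ∈ hcpTwoShellPattern, ‖v‖ = 1 ∧ (1 / 4 : ℝ) ≤ ⟪v, w⟫) →
    ∀ (N : ℕ) (x : Fin N → EuclideanSpace ℝ (Fin 3)) (i j : Fin N),
      IsTwoShellGood (1 / 20) (47 / 50) 1 x i → ¬ IsTwoShellGood (1 / 20) (47 / 50) 1 x j →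
      3 < dist (x j) (x i) →
      ∃ k : Fin N, k ≠ i ∧ dist (x k) (x i) ≤ 21 / 20 ∧ dist (x j) (x k) < dist (x j) (x i) := by
  intro hF hH N x i j hi _ hd
  obtain ⟨a, ha1, ha2, A, P, f, hP, hf, -, -⟩ := hi
  -- the covering fact for the pattern `P`
  have hcov : ∀ w : EuclideanSpace ℝ (Fin 3), ‖w‖ = 1 →
      ∃ v ∈ P, ‖v‖ = 1 ∧ (1 / 4 : ℝ) ≤ ⟪v, w⟫ := by
    rcases hP with rfl | rfl
    exacts [hF, hH]
  have ha0 : 0 < a := by linarith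
  set d := dist (x j) (x i) with hd_def
  have hd0 : 0 < d := by linarith
  -- the unit direction from `x i` towards `x j`
  set p : EuclideanSpace ℝ (Fin 3) := x j - x i with hp_def
  have hp : ‖p‖ = d := by rw [hd_def, dist_eq_norm]
  set u : EuclideanSpace ℝ (Fin 3) := d⁻¹ • p with hu_def
  have hu : ‖u‖ = 1 := by
    rw [hu_def, norm_smul, norm_inv, Real.norm_of_nonneg hd0.le, hp, inv_mul_cancel₀ hd0.ne']
  have hpu : p = d • u := by rw [hu_def, smul_smul, mul_inv_cancel₀ hd0.ne', one_smul]
  -- pull `u` back through `A`, an isometric automorphism of the finite-dimensional space `ℝ³`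
  set w : EuclideanSpace ℝ (Fin 3) := (A.toLinearIsometryEquiv rfl).symm u with hw_def
  have hw : ‖w‖ = 1 := by rw [hw_def, LinearIsometryEquiv.norm_map, hu]
  have hAw : A w = u := by
    rw [hw_def, ← LinearIsometry.coe_toLinearIsometryEquiv A rfl]
    exact (A.toLinearIsometryEquiv rfl).apply_symm_apply u
  obtain ⟨v, hv, hv1, hvw⟩ := hcov w hw
  have hAvu : (1 / 4 : ℝ) ≤ ⟪u, A v⟫ := by
    rw [← hAw, LinearIsometry.inner_map_map, real_inner_comm]
    exact hvw
  obtain ⟨hki, hk⟩ := hf v hv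
  -- the core estimate with `y := x (f v) - x i`, `z := a • A v`
  have hz : ‖a • A v‖ = a := by
    rw [norm_smul, Real.norm_of_nonneg ha0.le, A.norm_map, hv1, mul_one]
  have hyz : ‖x (f v) - x i - a • A v‖ ≤ a / 20 := by
    rw [dist_eq_norm, sub_add_eq_sub_sub] at hk
    linarith
  have hinner : d * a / 4 ≤ ⟪p, a • A v⟫ := by
    rw [hpu, real_inner_smul_left, real_inner_smul_right]
    have h := mul_le_mul_of_nonneg_left hAvu (mul_pos hd0 ha0).le
    calc d * a / 4 = d * a * (1 / 4) := by ring
      _ ≤ d * a * ⟪u, A v⟫ := h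
      _ = d * (a * ⟪u, A v⟫) := by ring
  obtain ⟨h1, h2⟩ := descent_core hd ha0 ha2 hp hz hyz hinner
  refine ⟨f v, hki, ?_, ?_⟩
  · rwa [dist_eq_norm]
  · rw [dist_eq_norm, ← sub_sub_sub_cancel_right (x j) (x (f v)) (x i)]
    exact h2

end Summit.AtomisticToContinuum.Crystallization.Theorems.PhononSlackCertificatesNearFarGlueR

end
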